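import Mathlib.FieldTheory.Relrank
import Mathlib.FieldTheory.RatFunc.IntermediateField
import Literature.NumberTheory.EllipticCurves.FrobeniusDegreeProofs
import Literature.NumberTheory.EllipticCurves.IsogenyDeterminantProofs
import HarnessLib

/-!
# `[k(x) : k(a(x)/b(x))] = max(deg a, deg b)`, and `deg ψ` from a reduced fraction for `ψ^* x'`

Trunk T-ELLARITH (group G16). A *proofs* file (theorems only) on top of `IsogenyDegree` /
`IsogenyDegreeKernelProofs` / `FrobeniusDegreeProofs`, providing the classical degree formula for a
rational function and its consequence for degrees of isogenies:

* `Literature.NumberTheory.EllipticCurves.relfinrank_adjoin_div_adjoin`: for `x ∈ L` transcendental over a field `k` and coprime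
  `a, b ∈ k[X]`, `b ≠ 0`, `[k(x) : k(a(x)/b(x))] = max(deg a, deg b)`. This is **Mathlib's**
  `RatFunc.finrank_eq_max_natDegree` (`[K(X) : K(f)] = max(deg num f, deg denom f)`, file
  `Mathlib/FieldTheory/RatFunc/IntermediateField.lean`, the degree lemma behind Mathlib's proof of
  Lüroth's theorem), transported from `RatFunc k` to `k(x) ⊆ L` along
  `RatFunc.algEquivOfTranscendental x hx`, with `deg num(a/b) = deg a`, `deg denom(a/b) = deg b`
  for coprime `a, b` (`natDegree_num_div_eq_and_natDegree_denom_div_eq`). (The special case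
  `r = x^n` is `Literature.NumberTheory.EllipticCurves.finrank_adjoin_pow_adjoin` of `FrobeniusDegreeProofs`.)
* `WeierstrassCurve.finrank_adjoin_genX_eq_two`: `[K̄(E) : K̄(x)] = 2` (Silverman, *AEC*,
  III.§1–2), extracted from the proof of `frobeniusIsogeny_deg_eq_card_holds`.
* `WeierstrassCurve.Isogeny.finrank_adjoin_pullbackX`: `[K̄(E) : K̄(ψ^* x')] = 2 deg ψ` for an
  isogeny `ψ : E → E'` (the tower `K̄(ψ^* x') ⊆ ψ^* K̄(E') ⊆ K̄(E)`, the bottom step being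
  `[K̄(E') : K̄(x')] = 2` transported along `ψ^*`).
* `WeierstrassCurve.Isogeny.deg_eq_max_natDegree_of_pullbackX_eq`: **if `ψ^* x' = a(x)/b(x)`
  with `a, b ∈ K̄[X]` coprime, then `deg ψ = max(deg a, deg b)`** (for any isogeny `ψ : E → E'`).
  This is how Manin's degrees `d_n = deg(numerator of x(P₀ + nQ))`
  (`Literature.NumberTheory.EllipticCurves.HasseManin`) become degrees of the endomorphisms `φ + n`
  (Chahal–Soomro–Top 2014, §1), in the sequel `FrobeniusAddIntDegreeProofs`.

## References

* [SilvermanAEC2009] J. H. Silverman, *The Arithmetic of Elliptic Curves*, 2nd ed., GTM 106,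
  Springer 2009: II.§2 (degrees of maps), III.§1–2 (`[K̄(E) : K̄(x)] = 2`), Exercise 3.7(d) and
  proof of Thm. III.6.2(d) (`deg [m] = m²` read off `x ∘ [m] = Φₘ/Ψₘ²`).
* J. S. Chahal, A. Soomro, J. Top, *A supplement to Manin's proof of the Hasse inequality*, Rocky
  Mountain J. Math. 44 (2014), §1 (`d_n = deg(φ + n)`).

## Design

`noncomputable section`, `open scoped Classical`, one universe `u`; nothing is defined; the
general field-theoretic statement lives in `namespace Literature` (a transport of Mathlib's
`RatFunc.finrank_eq_max_natDegree`, not a re-proof), the elliptic-curve statements are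
dot-notation extensions in `namespace WeierstrassCurve(.Isogeny)`.
-/

noncomputable section

open scoped Classical

open Polynomial IntermediateField

universe u

/-! ## The degree of `k(x)` over `k(a(x)/b(x))` -/

namespace Literature.NumberTheory.EllipticCurves

variable {k : Type u} [Field k]

/-- For coprime `a, b ∈ k[X]`, `b ≠ 0`, the reduced numerator and denominator of the rational
function `a/b ∈ RatFunc k` are associates of `a` and `b`; in particular they have the same
degrees (`num (a/b) · b = a · denom (a/b)`, Mathlib's `RatFunc.num_mul_eq_mul_denom_iff`, with
both pairs coprime). [folklore] -/
theorem natDegree_num_div_eq_and_natDegree_denom_div_eq {a b : k[X]} (hb : b ≠ 0)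
    (hab : IsCoprime a b) :
    (algebraMap k[X] (RatFunc k) a / algebraMap k[X] (RatFunc k) b).num.natDegree = a.natDegree ∧
      (algebraMap k[X] (RatFunc k) a / algebraMap k[X] (RatFunc k) b).denom.natDegree =
        b.natDegree := by
  set f := algebraMap k[X] (RatFunc k) a / algebraMap k[X] (RatFunc k) b with hf
  have key : f.num * b = a * f.denom := (RatFunc.num_mul_eq_mul_denom_iff hb).mpr hf
  have hcop := RatFunc.isCoprime_num_denom f
  have ha : Associated a f.num :=
    associated_of_dvd_dvd (hab.dvd_of_dvd_mul_right (key ▸ dvd_mul_right a f.denom))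
      (hcop.dvd_of_dvd_mul_right (key.symm ▸ dvd_mul_right f.num b))
  have hb' : Associated b f.denom :=
    associated_of_dvd_dvd (hab.symm.dvd_of_dvd_mul_left (key.symm ▸ dvd_mul_left b f.num))
      (hcop.symm.dvd_of_dvd_mul_left (key ▸ dvd_mul_left f.denom a))
  exact ⟨(natDegree_eq_of_degree_eq (degree_eq_degree_of_associated ha)).symm,
    (natDegree_eq_of_degree_eq (degree_eq_degree_of_associated hb')).symm⟩

variable {L : Type u} [Field L] [Algebra k L]

/-- **`[k(x) : k(r)] = max(deg a, deg b)` for `r = a(x)/b(x)`**, `x ∈ L` transcendental over `k`,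
`a, b ∈ k[X]` coprime, `b ≠ 0` — Mathlib's `RatFunc.finrank_eq_max_natDegree`
(`[K(X) : K(f)] = max(deg num f, deg denom f)`) transported along the `k`-isomorphism
`RatFunc k ≃ k(x)` of `RatFunc.algEquivOfTranscendental` (relative degrees are preserved under
field embeddings, `IntermediateField.relfinrank_map_map`). [folklore] -/
theorem relfinrank_adjoin_div_adjoin {x : L} (hx : Transcendental k x) {a b : k[X]} (hb : b ≠ 0)
    (hab : IsCoprime a b) :
    IntermediateField.relfinrank k⟮aeval x a / aeval x b⟯ k⟮x⟯ = max a.natDegree b.natDegree := by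
  set f := algebraMap k[X] (RatFunc k) a / algebraMap k[X] (RatFunc k) b with hf
  have key : f.num * b = a * f.denom := (RatFunc.num_mul_eq_mul_denom_iff hb).mpr hf
  set e := RatFunc.algEquivOfTranscendental x hx with he
  set ι : RatFunc k →ₐ[k] L := (k⟮x⟯.val).comp (e : RatFunc k →ₐ[k] k⟮x⟯) with hι
  -- `ι f = a(x)/b(x)`
  have hne : ∀ {p : k[X]}, p ≠ 0 → aeval x p ≠ 0 := fun {p} hp h ↦
    hp ((injective_iff_map_eq_zero _).mp (transcendental_iff_injective.mp hx) p h)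
  have hιf : ι f = aeval x a / aeval x b := by
    have h1 : ι f = aeval x f.num / aeval x f.denom := RatFunc.algEquivOfTranscendental_apply x hx f
    rw [h1, div_eq_div_iff (hne f.denom_ne_zero) (hne hb), ← map_mul, ← map_mul, key]
  -- the images of `⊤` and of `k(f)` under `ι`
  have htop : (⊤ : IntermediateField k (RatFunc k)).map ι = k⟮x⟯ := by
    rw [hι, ← IntermediateField.map_map, ← AlgHom.fieldRange_eq_map,
      AlgHom.fieldRange_eq_top.mpr e.surjective, ← AlgHom.fieldRange_eq_map,
      IntermediateField.fieldRange_val]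
  have hadj : (k⟮f⟯).map ι = k⟮aeval x a / aeval x b⟯ := by
    rw [IntermediateField.adjoin_map, Set.image_singleton, hιf]
  have h := IntermediateField.relfinrank_map_map k⟮f⟯ ⊤ ι
  rw [hadj, htop, IntermediateField.relfinrank_top_right, RatFunc.finrank_eq_max_natDegree] at h
  obtain ⟨hn, hd⟩ := natDegree_num_div_eq_and_natDegree_denom_div_eq hb hab
  rw [h, hn, hd]

end Literature.NumberTheory.EllipticCurves

/-! ## `[K̄(E) : K̄(x)] = 2` and `[K̄(E) : K̄(ψ^* x')] = 2 deg ψ` -/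

namespace WeierstrassCurve

open geomPoints

variable {K : Type u} [Field K] {W W' : WeierstrassCurve K}

variable (W) in
/-- **`y ∉ K̄(x)`** over any base field (the tree's `genY_not_mem_adjoin_genX` assumes the base
field finite): an element of `K̄(x)` takes the same value at `P` and `-P` for almost all `P`
(`exists_finite_hasValueAt_neg_of_mem_adjoin_simple`), while `y(P) = y(-P)` forces `2P = O`.
Silverman, *AEC*, III.§1–2 (`[K̄(E) : K̄(x)] = 2`). [folklore] -/
theorem genY_not_mem_adjoin_simple_genX [W.IsElliptic] :
    W.genY ∉ IntermediateField.adjoin (AlgebraicClosure K) {W.genX} := by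
  intro hmem
  obtain ⟨S, hS, hSP⟩ := exists_finite_hasValueAt_neg_of_mem_adjoin_simple
    (by simpa using exists_finite_hasValueAt_neg_genX_pow W 1) hmem
  apply ((hS.union (Set.finite_singleton (0 : W.geomPoints)))).infinite_compl
  refine (finite_geomTorsion W (two_ne_zero : (2 : ℤ) ≠ 0)).subset fun P hP ↦ ?_
  simp only [Set.mem_compl_iff, Set.mem_union, Set.mem_singleton_iff, not_or] at hP
  obtain ⟨hPS, hP0⟩ := hP
  have hnP0 : -P ≠ 0 := fun h ↦ hP0 (neg_eq_zero.mp h)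
  obtain ⟨c, hc, hc'⟩ := hSP P hPS
  have h1 : xy P 1 = c := (hasValueAt_gen P 1).unique hP0 hc
  have h2 : xy (-P) 1 = c := (hasValueAt_gen (-P) 1).unique hnP0 hc'
  exact (mem_torsionPoints_iff _ _ P).mpr
    (geomPoints.two_smul_eq_zero_of_xy_neg_one hP0 (h1.trans h2.symm))

variable (W) in
/-- **`[K̄(E) : K̄(x)] = 2`**: `y` is a root of the (monic quadratic) Weierstrass equation over
`K̄(x)` and `y ∉ K̄(x)`, and `K̄(E) = K̄(x)(y)`. Silverman, *AEC*, III.§1–2. [folklore] -/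
theorem finrank_adjoin_genX_eq_two [W.IsElliptic] :
    Module.finrank (IntermediateField.adjoin (AlgebraicClosure K) {W.genX}) W.geomFunctionField = 2 := by
  set L₁ : IntermediateField (AlgebraicClosure K) W.geomFunctionField :=
    IntermediateField.adjoin (AlgebraicClosure K) {W.genX} with hL₁
  have hxL₁ : W.genX ∈ L₁ := mem_adjoin_simple_self _ _
  obtain ⟨hyint, hy2⟩ := isIntegral_and_finrank_adjoin_le_two W L₁ hxL₁ (equation_genX_genY W)
  have hy1 := finrank_adjoin_ne_one_of_not_mem W L₁ (genY_not_mem_adjoin_simple_genX W)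
  have htop : IntermediateField.adjoin L₁ {W.genY} = ⊤ := by
    rw [eq_top_iff]
    intro z _
    have hle : IntermediateField.adjoin (AlgebraicClosure K) {W.genX, W.genY} ≤
        (IntermediateField.adjoin L₁ {W.genY}).restrictScalars (AlgebraicClosure K) := by
      rw [IntermediateField.adjoin_le_iff]
      rintro w (rfl | hw)
      · exact IntermediateField.algebraMap_mem (IntermediateField.adjoin L₁ {W.genY})
          (⟨W.genX, hxL₁⟩ : L₁)
      · rw [Set.mem_singleton_iff.mp hw]
        exact mem_adjoin_simple_self _ W.genY
    exact hle (by rw [adjoin_genX_genY_eq_top]; trivial)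
  have hfr : Module.finrank L₁ (IntermediateField.adjoin L₁ {W.genY}) =
      Module.finrank L₁ W.geomFunctionField := by
    rw [htop, IntermediateField.finrank_top']
  rw [← hfr]
  haveI : FiniteDimensional L₁ (IntermediateField.adjoin L₁ {W.genY}) :=
    adjoin.finiteDimensional hyint
  haveI : Module.IsTorsionFree L₁ (IntermediateField.adjoin L₁ {W.genY}) :=
    DivisionSemiring.to_moduleIsTorsionFree
  have hpos : 0 < Module.finrank L₁ (IntermediateField.adjoin L₁ {W.genY}) := Module.finrank_pos
  omega

namespace Isogeny

variable [W.IsElliptic] [W'.IsElliptic] (ψ : Isogeny W W')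

/-- **`[K̄(E) : K̄(ψ^* x')] = 2 deg ψ`** for an isogeny `ψ : E → E'`: `K̄(ψ^* x') = ψ^*(K̄(x'))`
sits in the tower `ψ^* K̄(x') ⊆ ψ^* K̄(E') ⊆ K̄(E)`, with `[ψ^* K̄(E') : ψ^* K̄(x')] =
[K̄(E') : K̄(x')] = 2`. Silverman, *AEC*, II.§2, III.§1. [folklore] -/
theorem finrank_adjoin_pullbackX :
    Module.finrank (IntermediateField.adjoin (AlgebraicClosure K) {ψ.pullbackX}) W.geomFunctionField =
      2 * ψ.deg := by
  set f := ψ.pullbackHom with hf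
  have hmap : (IntermediateField.adjoin (AlgebraicClosure K) {W'.genX}).map f =
      IntermediateField.adjoin (AlgebraicClosure K) {ψ.pullbackX} := by
    rw [IntermediateField.adjoin_map, Set.image_singleton, pullbackHom_genX]
  have htop : (⊤ : IntermediateField _ W'.geomFunctionField).map f = ψ.pullbackField := by
    rw [← AlgHom.fieldRange_eq_map, ψ.fieldRange_pullbackHom]
  have hle : (IntermediateField.adjoin (AlgebraicClosure K) {W'.genX}).map f ≤
      (⊤ : IntermediateField _ W'.geomFunctionField).map f := IntermediateField.map_mono f le_top
  have h1 := IntermediateField.relfinrank_mul_finrank_top hle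
  rw [IntermediateField.relfinrank_map_map, IntermediateField.relfinrank_top_right,
    finrank_adjoin_genX_eq_two W', htop, hmap] at h1
  rw [← h1, Isogeny.deg]

end Isogeny

/-- **`deg ψ = max(deg a, deg b)` if `ψ^* x' = a(x)/b(x)` with `a, b ∈ K̄[X]` coprime**, for an
isogeny `ψ : E → E'`: `2 deg ψ = [K̄(E) : K̄(ψ^* x')] = [K̄(E) : K̄(x)] [K̄(x) : K̄(ψ^* x')] =
2 max(deg a, deg b)`. This is how Silverman reads `deg [m] = m²` off `x ∘ [m] = Φₘ/Ψₘ²`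
(proof of Thm. III.6.2(d), Exercise 3.7) and how Manin's `d_n` is `deg(φ + n)`
(Chahal–Soomro–Top 2014, §1). [folklore] -/
theorem Isogeny.deg_eq_max_natDegree_of_pullbackX_eq [W.IsElliptic] [W'.IsElliptic]
    (ψ : Isogeny W W') {a b : (AlgebraicClosure K)[X]} (hab : IsCoprime a b)
    (hψ : ψ.pullbackX = aeval W.genX a / aeval W.genX b) :
    ψ.deg = max a.natDegree b.natDegree := by
  -- `b ≠ 0` and `max(deg a, deg b) ≥ 1`: otherwise `ψ^* x'` would be constant, but it is
  -- transcendental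
  have hb : b ≠ 0 := by
    rintro rfl
    apply ψ.transcendental_pullbackX
    rw [hψ, map_zero, div_zero]
    exact isAlgebraic_zero
  have hrel := Literature.NumberTheory.EllipticCurves.relfinrank_adjoin_div_adjoin (transcendental_genX W) hb hab
  rw [← hψ] at hrel
  have hmem : ∀ q : (AlgebraicClosure K)[X],
      aeval W.genX q ∈ IntermediateField.adjoin (AlgebraicClosure K) {W.genX} := fun q ↦
    algebra_adjoin_le_adjoin (AlgebraicClosure K) {W.genX} (aeval_mem_adjoin_singleton _ W.genX)
  have hle : IntermediateField.adjoin (AlgebraicClosure K) {ψ.pullbackX} ≤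
      IntermediateField.adjoin (AlgebraicClosure K) {W.genX} := by
    rw [IntermediateField.adjoin_simple_le_iff, hψ]
    exact div_mem (hmem a) (hmem b)
  have htower := IntermediateField.relfinrank_mul_finrank_top hle
  rw [hrel, finrank_adjoin_genX_eq_two W, ψ.finrank_adjoin_pullbackX] at htower
  omega

end WeierstrassCurve
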